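/-
Copyright (c) 2026 the pub-hodgecm-mathlib formalisation cell (harness21).  Prover seat hodgecm-mathlib-K2Liu-p02 (g2),
Track B «K2-LIT» ∕ hLiu418 #184♮, unit U6 «FIRST TERM», socket #42R (steward): the unimodularity clause of the standard extension
(DEFS leaf O42.3d `K2Lit/SiegelStandardExtension`), discharged for EVERY Iwasawa datum from the continuous `P_Δ`-height ★ #15a.  2026-09-04.
-/
import Literature.NumberTheory.K2Lit.SiegelStandardSections                                   -- ★ D1′: `IwasawaDatum`
import Summits.HodgeConjecture.HodgeConjecture.Theorems.K2LiuSiegelDeltaHeightExists            -- ★ #15a: `siegelDeltaHeightExists`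
import HarnessLib

/-!
# K2_Liu road (hLiu418 = stmt-HodgeConjecture-24832): every Iwasawa datum is UNIMODULAR ALONG `Δ` — `|det_Δ k|_{𝔸} = 1` on `K ∩ P_Δ(𝔸)`

Cell `pub/hodgecm-mathlib` (D-0151), Track B; steward file for socket #42R (`sig_K2LiuEisensteinResidueIsThetaIntegral`, K2Liu-p02 (g2)).
The standard (flat) extension `f_s(h) = |det_Δ p_h|^{s−s₀} φ(h)` of a Siegel section along an Iwasawa decomposition `H(𝔸) = P_Δ(𝔸)·K`
(DEFS leaf O42.3d `Literature/NumberTheory/K2Lit/SiegelStandardExtension.lean`, displayed clause `IwasawaDatum.IsDeltaUnimodular`) is well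
defined because the modulus `|det_Δ ·|^{1/2}` (★ `modDelta`) is `1` on `K ∩ P_Δ(𝔸)`.  THIS FILE proves that clause for EVERY Iwasawa datum
(★ `IwasawaDatum`: `K` compact, `H(𝔸) = P_Δ(𝔸)·K`) of a non-degenerate frame, from the continuous `P_Δ`-height of ★ #15a
`K2LiuSiegelDeltaHeightExists.siegelDeltaHeightExists` (`Φ > 0` continuous, `Φ(p x) = modDelta p · Φ(x)`): for `k ∈ K ∩ P_Δ(𝔸)` and every
`m`, `modDelta(k)^m · Φ(1) = Φ(k^m)` lies in the bounded set `Φ(K)` (continuous image of a compact), and so does `modDelta(k)^{−m}·Φ(1) = Φ(k^{−m})`;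
a positive real all of whose integer powers are bounded is `1`.

* `modDelta_pow_mul_height` — `Φ(k^m) = modDelta(k)^m · Φ(1)` for `k ∈ P_Δ(𝔸)`.
* **`modDelta_eq_one_of_mem_compact_subgroup`** — `modDelta k = 1` for `k ∈ P_Δ(𝔸)` lying in a compact SUBGROUP of `H(𝔸)`.
* **`IwasawaDatum.modDelta_eq_one_of_mem`** — the clause `∀ k ∈ 𝒦.K, IsSiegelDelta k → modDelta k = 1` (= `IsDeltaUnimodular 𝒦` of the DEFS leaf).

Mathlib + ★ only; no `sorry`, no definition, no instance.  HONEST LABEL: HC_CM is proved only modulo the 7 printed citations (2 remaining named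
inputs: hLiu418 = stmt-HodgeConjecture-24832, h413 = stmt-HodgeConjecture-24833) until rung 0 closes; this file is a `--supports
stmt-HodgeConjecture-24832 --as helper` file and retires nothing by itself.

References: [Garrett2018] P. Garrett, *Modern Analysis of Automorphic Forms by Example* (2018) §3.10; [MoeglinWaldspurger1995] I.2.2, II.1.5
(`m_P` trivial on `K ∩ P`); [Tan1999] §1; [KudlaRallis1994] §1.
-/

set_option autoImplicit false
set_option linter.dupNamespace false

noncomputable section

open NumberField IsDedekindDomain
open scoped Matrix

namespace Summit.HodgeConjecture.HodgeConjecture.Cruxes.HLiu418.K2LiuIwasawaDeltaUnimodular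

open Literature.NumberTheory.Automorphic Literature.NumberTheory.GaloisRepresentations
open Literature.NumberTheory.GelbartRogawski1991 Literature.NumberTheory.GelbartRogawski1991.GRConstruction
open Literature.NumberTheory.K2Lit.SiegelDoubled
open Summit.HodgeConjecture.HodgeConjecture.Cruxes.HLiu418.K2LiuSiegelDeltaHeightExists (siegelDeltaHeightExists)

variable (L : Type) [Field L] [NumberField L] [IsCMField L]
variable {N M n : ℕ} (e : Fin N × Fin M ≃ Fin n)
  (dV : Fin N → L) (hdV : ∀ i, IsCMField.complexConj L (dV i) = dV i) (hdV0 : ∀ i, dV i ≠ 0)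
  (dW : Fin M → L) (hdW : ∀ i, IsCMField.complexConj L (dW i) = dW i) (hdW0 : ∀ i, dW i ≠ 0)

/-- `Φ(k^m) = modDelta(k)^m · Φ(1)` for a `P_Δ`-height `Φ` and `k ∈ P_Δ(𝔸)`. [cite: Garrett2018, §3.10] -/
theorem modDelta_pow_mul_height {Φ : HA L e dV hdV dW hdW → ℝ}
    (hΦ : ∀ p x : HA L e dV hdV dW hdW, IsSiegelDelta L e dV hdV dW hdW p → Φ (p * x) = modDelta L e dV hdV dW hdW p * Φ x)
    {k : HA L e dV hdV dW hdW} (hk : IsSiegelDelta L e dV hdV dW hdW k) (m : ℕ) :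
    Φ (k ^ m) = modDelta L e dV hdV dW hdW k ^ m * Φ 1 := by
  induction m with
  | zero => rw [pow_zero, pow_zero, one_mul]
  | succ m ih => rw [pow_succ', hΦ k _ hk, ih, pow_succ', mul_assoc]

include hdV0 hdW0 in
/-- **`|det_Δ k|^{1/2} = 1` for every `k ∈ P_Δ(𝔸)` in a COMPACT SUBGROUP of `H(𝔸)`**: with the continuous height `Φ` of ★ #15a, all integer powers
`modDelta(k)^{±m} = Φ(k^{±m})/Φ(1)` are bounded by `sup_C Φ / Φ(1)`; a positive real with bounded powers and bounded inverse powers is `1`.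
[cite: MoeglinWaldspurger1995, I.2.2] [cite: Garrett2018, §3.10] -/
theorem modDelta_eq_one_of_mem_compact_subgroup (C : Subgroup (HA L e dV hdV dW hdW)) (hC : IsCompact (C : Set (HA L e dV hdV dW hdW)))
    {k : HA L e dV hdV dW hdW} (hkC : k ∈ C) (hk : IsSiegelDelta L e dV hdV dW hdW k) : modDelta L e dV hdV dW hdW k = 1 := by
  obtain ⟨Φ, hΦc, hΦpos, hΦ⟩ := siegelDeltaHeightExists L e dV hdV hdV0 dW hdW hdW0
  -- `Φ` is bounded on the compact `C`
  obtain ⟨B, hB⟩ : ∃ B : ℝ, ∀ x ∈ (C : Set (HA L e dV hdV dW hdW)), Φ x ≤ B := by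
    obtain ⟨B, hB⟩ := (hC.image hΦc).isBounded.bddAbove
    exact ⟨B, fun x hx => hB ⟨x, hx, rfl⟩⟩
  set t := modDelta L e dV hdV dW hdW k with ht
  have htpos : 0 < t := modDelta_pos L e dV hdV dW hdW k
  have hΦ1 : 0 < Φ 1 := hΦpos 1
  -- all natural powers of `t` and of `t⁻¹` are bounded by `B / Φ 1`
  have hpow : ∀ m : ℕ, t ^ m ≤ B / Φ 1 := fun m => by
    rw [le_div_iff₀ hΦ1, ht, ← modDelta_pow_mul_height L e dV hdV dW hdW hΦ hk m]
    exact hB _ (C.pow_mem hkC m)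
  have hkinv : IsSiegelDelta L e dV hdV dW hdW k⁻¹ := isSiegelDelta_inv L e dV hdV dW hdW hk
  have htinv : modDelta L e dV hdV dW hdW k⁻¹ = t⁻¹ := by
    have h1 := modDelta_mul L e dV hdV dW hdW hk hkinv
    rw [mul_inv_cancel, modDelta_one'] at h1
    exact eq_inv_of_mul_eq_one_right h1.symm
  have hpow' : ∀ m : ℕ, t⁻¹ ^ m ≤ B / Φ 1 := fun m => by
    rw [le_div_iff₀ hΦ1, ← htinv, ← modDelta_pow_mul_height L e dV hdV dW hdW hΦ hkinv m]
    exact hB _ (C.pow_mem (C.inv_mem hkC) m)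
  -- hence `t = 1`
  by_contra hne
  rcases lt_or_gt_of_ne hne with hlt | hgt
  · -- `t < 1`: powers of `t⁻¹ > 1` are unbounded
    have h1 : 1 < t⁻¹ := (one_lt_inv₀ htpos).2 hlt
    obtain ⟨m, hm⟩ := pow_unbounded_of_one_lt (B / Φ 1) h1
    exact (lt_irrefl _) (hm.trans_le (hpow' m))
  · obtain ⟨m, hm⟩ := pow_unbounded_of_one_lt (B / Φ 1) hgt
    exact (lt_irrefl _) (hm.trans_le (hpow m))

include hdV0 hdW0 in
/-- **EVERY IWASAWA DATUM IS UNIMODULAR ALONG `Δ`**: for `𝒦 : IwasawaDatum` (compact `K` with `H(𝔸) = P_Δ(𝔸)·K`) and `k ∈ K ∩ P_Δ(𝔸)`,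
`|det_Δ k|^{1/2} = 1` — the displayed clause `IwasawaDatum.IsDeltaUnimodular 𝒦` of the standard-extension leaf, discharged.
[cite: MoeglinWaldspurger1995, II.1.5] [cite: Tan1999, §1] -/
theorem IwasawaDatum.modDelta_eq_one_of_mem (𝒦 : IwasawaDatum L e dV hdV dW hdW) :
    ∀ k : HA L e dV hdV dW hdW, k ∈ 𝒦.K → IsSiegelDelta L e dV hdV dW hdW k → modDelta L e dV hdV dW hdW k = 1 :=
  fun _ hk hkP => modDelta_eq_one_of_mem_compact_subgroup L e dV hdV hdV0 dW hdW hdW0 𝒦.K 𝒦.isCompact_K hk hkP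

end Summit.HodgeConjecture.HodgeConjecture.Cruxes.HLiu418.K2LiuIwasawaDeltaUnimodular

end
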